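import Summits.MatrixMultiplication.MatrixMultiplication.Theorems.SaturationLadderTwinFamilyX
import HarnessLib

/-!
# SaturationLadder — the twin rung `TwinSaturation` PROVED

Route `SaturationLadder` (sub-problem `MatrixMultiplication`), aside item `TwinSaturation`
(stmt-MatrixMultiplication-30539):

  `∃ C, ∀ t ∈ [0,1), ∃ r, 1 ≤ r ≤ C · 3^{1/(1−t)} ∧ ω(1, t, r) ≤ 1 + r`

— the saturation abscissa of the rectangular exponent is at most `C · 3^{1/(1−t)}` for EVERY `t < 1`
(the Coppersmith–Winograd level-1 value is `4^{1/(1−t)}`).  The certificates are the exact twin-tensor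
points `ω(1, t_j, r_j) = 1 + r_j` of `Theorems/SaturationLadderTwinExact.lean` along the STAGE-2 family
of `Theorems/SaturationLadderTwinFamily.lean`; `Theorems/SaturationLadderTwinFamilyX.lean` proved the
`X`-entropy inequality and reduced the rung to the `Y`-inequality, which is proved here:

* `log_five_halves_le`: `log (5/2) ≤ 0.91662` (Taylor remainder of `log(1 − 1/5)`).
* `familyY`: `H(Z_j) ≤ H(Y_j)` for all `j ≥ 1000`, where `Z_j = (2, 2^{j+1}, 1)/d` and
  `Y_j = (α/d, 1 − τ/d, γ/d)`, `α = 5/2 + 37ε/20`, `γ = 1/2 − ε`, `τ = α + γ = 3 + 17ε/20`, `ε = 1/j`: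
  `d ×` the difference in nats is at least
  `3.35 log 2 − 2.5 log(5/2) − 0.15 ε log 2 − 1.85 ε log(5/2) − 3.369 ε² − 19/2^{j+1} ≥ 0.028`.
* `twinSaturation`: **`TwinSaturation`** (unconditional).

No named facts, no sorry (cell `decomp-mm`, lens 1, gen 8).
-/

set_option linter.dupNamespace false
-- (single-conjunct summit: the namespace repeats `MatrixMultiplication`)

noncomputable section

namespace Summit.MatrixMultiplication.MatrixMultiplication.Theorems.SaturationLadderTwinSaturation

open Literature.Computability.AlgebraicComplexity
open Summit.MatrixMultiplication.MatrixMultiplication.Theses.SaturationLadder (TwinSaturation)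
open Summit.MatrixMultiplication.MatrixMultiplication.Theorems.SaturationLadderTwinFamily
open Summit.MatrixMultiplication.MatrixMultiplication.Theorems.SaturationLadderTwinFamilyX
  (twinSaturation_of_familyY)

/-! ## A numerical bound for `log (5/2)` -/

/-- `log (5/2) ≤ 0.91662` (`log (5/2) = log 2 − log(1 − 1/5)`, four Taylor terms). [folklore] -/
theorem log_five_halves_le : Real.log (5 / 2) ≤ 0.91662 := by
  have h := Real.abs_log_sub_add_sum_range_le (x := (1 / 5 : ℝ))
    (by rw [abs_of_pos (by norm_num)]; norm_num) 4
  rw [abs_le] at h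
  have h1 := h.1
  simp only [Finset.sum_range_succ, Finset.sum_range_zero] at h1
  norm_num [abs_of_pos] at h1
  have e : Real.log (5 / 2) = Real.log 2 - Real.log (4 / 5) := by
    rw [← Real.log_div (by norm_num) (by norm_num)]; norm_num
  have hl2 := Real.log_two_lt_d9
  rw [e]; linarith

/-! ## The `Y`-inequality along the family -/

set_option maxHeartbeats 800000 in
/-- **`H(Z_j) ≤ H(Y_j)` for the STAGE-2 family, all `j ≥ 1000`.**
[cite: CoppersmithWinograd1990, §8] [cite: AlmanDuanVassilevskaWilliamsXuXuZhou2025, §3.4] -/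
theorem familyY (j : ℕ) (hj : 1000 ≤ j) :
    shannonEntropy
        ![((fN₁ j : ℝ) + fN₄ j + (0 : ℕ)) / (fN₁ j + fN₂ j + fN₃ j + fN₄ j + 0 + fN₆ j : ℕ),
        ((fN₂ j : ℝ) + fN₃ j) / (fN₁ j + fN₂ j + fN₃ j + fN₄ j + 0 + fN₆ j : ℕ),
        (fN₆ j : ℝ) / (fN₁ j + fN₂ j + fN₃ j + fN₄ j + 0 + fN₆ j : ℕ)] ≤
      shannonEntropy
        ![((fN₃ j : ℝ) + (0 : ℕ) + fN₆ j) / (fN₁ j + fN₂ j + fN₃ j + fN₄ j + 0 + fN₆ j : ℕ),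
        ((fN₁ j : ℝ) + fN₂ j) / (fN₁ j + fN₂ j + fN₃ j + fN₄ j + 0 + fN₆ j : ℕ),
        (fN₄ j : ℝ) / (fN₁ j + fN₂ j + fN₃ j + fN₄ j + 0 + fN₆ j : ℕ)] := by
  -- real abbreviations
  have hJ : (1000 : ℝ) ≤ (j : ℝ) := by exact_mod_cast hj
  have hB1 : (2 : ℝ) ^ 65 ≤ (2 : ℝ) ^ (j + 1) := pow_le_pow_right₀ (by norm_num) (by omega)
  have hBpos : (0 : ℝ) < (2 : ℝ) ^ (j + 1) := by positivity
  set B : ℝ := (2 : ℝ) ^ (j + 1) with hBdef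
  set d : ℝ := B + 3 with hddef
  have hdpos : 0 < d := by positivity
  have hBd : B ≤ d := by linarith
  have hjpos : (0 : ℝ) < j := by linarith
  -- the counts as reals
  have c₁ : ((fN₁ j : ℕ) : ℝ) = 30 * j + 20 := by unfold fN₁; push_cast; ring
  have c₂ : ((fN₂ j : ℕ) : ℝ) = 20 * j * B - (30 * j + 37) := by
    rw [fN₂_cast j (by omega)]
  have c₃ : ((fN₃ j : ℕ) : ℝ) = 30 * j + 37 := by unfold fN₃; push_cast; ring
  have c₄ : ((fN₄ j : ℕ) : ℝ) = 10 * j - 20 := fN₄_cast j (by omega)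
  have c₆ : ((fN₆ j : ℕ) : ℝ) = 20 * j := by unfold fN₆; push_cast; ring
  have cN : ((fN₁ j + fN₂ j + fN₃ j + fN₄ j + 0 + fN₆ j : ℕ) : ℝ) = 20 * j * d := by
    push_cast; rw [c₁, c₂, c₃, c₄, c₆, hddef]; ring
  -- the small parameter `ε = 1/j` and the `Y`-masses `α, γ, τ = α + γ` (units of `1/d`)
  set ε : ℝ := 1 / j with hεdef
  have hε0 : 0 ≤ ε := by positivity
  have hεle : ε ≤ 0.001 := by
    rw [hεdef, div_le_iff₀ hjpos]; nlinarith
  have hεJ : ε * j = 1 := by rw [hεdef]; field_simp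
  set α : ℝ := 5 / 2 + 37 / 20 * ε with hαdef
  set γ : ℝ := 1 / 2 - ε with hγdef
  set τ : ℝ := 3 + 17 / 20 * ε with hτdef
  have hαpos : 0 < α := by rw [hαdef]; positivity
  have hγpos : 0 < γ := by rw [hγdef]; linarith
  have hd65 : (2 : ℝ) ^ 65 ≤ d := hB1.trans hBd
  have hτd : τ / d < 1 := by
    rw [div_lt_one hdpos]; linarith [hεle, hd65]
  -- the entries: `Z = (2, B, 1)/d`, `Y = (α/d, 1 − τ/d, γ/d)`
  have eZ0 : ((fN₁ j : ℝ) + fN₄ j + (0 : ℕ)) / (fN₁ j + fN₂ j + fN₃ j + fN₄ j + 0 + fN₆ j : ℕ) =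
      2 / d := by
    rw [cN, c₁, c₄]; push_cast; field_simp; ring
  have eZ1 : ((fN₂ j : ℝ) + fN₃ j) / (fN₁ j + fN₂ j + fN₃ j + fN₄ j + 0 + fN₆ j : ℕ) = B / d := by
    rw [cN, c₂, c₃]; field_simp; ring
  have eZ2 : (fN₆ j : ℝ) / (fN₁ j + fN₂ j + fN₃ j + fN₄ j + 0 + fN₆ j : ℕ) = 1 / d := by
    rw [cN, c₆]; field_simp
  have eY0 : ((fN₃ j : ℝ) + (0 : ℕ) + fN₆ j) / (fN₁ j + fN₂ j + fN₃ j + fN₄ j + 0 + fN₆ j : ℕ) =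
      α / d := by
    rw [cN, c₃, c₆, hαdef, hεdef]; push_cast; field_simp; ring
  have eY1 : ((fN₁ j : ℝ) + fN₂ j) / (fN₁ j + fN₂ j + fN₃ j + fN₄ j + 0 + fN₆ j : ℕ) =
      1 - τ / d := by
    rw [cN, c₁, c₂, hτdef, hεdef]; field_simp; ring
  have eY2 : (fN₄ j : ℝ) / (fN₁ j + fN₂ j + fN₃ j + fN₄ j + 0 + fN₆ j : ℕ) = γ / d := by
    rw [cN, c₄, hγdef, hεdef]; field_simp; ring
  rw [eZ0, eZ1, eZ2, eY0, eY1, eY2]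
  -- unfold the entropies (bits → nats)
  have hlog2 : 0 < Real.log 2 := Real.log_pos one_lt_two
  rw [shannonEntropy_def, shannonEntropy_def, div_le_div_iff_of_pos_right hlog2]
  simp only [Fin.sum_univ_three, Matrix.cons_val_zero, Matrix.cons_val_one, Matrix.cons_val_two,
    Matrix.head_cons, Matrix.tail_cons]
  -- (Z) the left side in closed form and its upper bound (as in `familyX`)
  have hZ : Real.negMulLog (2 / d) + Real.negMulLog (B / d) + Real.negMulLog (1 / d) =
      (Real.log d - Real.log B) + ((3 * (j : ℝ) + 1) * Real.log 2) / d := by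
    have hlogB : Real.log B = ((j : ℝ) + 1) * Real.log 2 := by
      rw [hBdef, Real.log_pow]; push_cast; ring
    simp only [Real.negMulLog, Real.log_div two_ne_zero hdpos.ne', Real.log_div hBpos.ne' hdpos.ne',
      Real.log_div one_ne_zero hdpos.ne', Real.log_one]
    rw [hlogB]
    have : d = B + 3 := hddef
    field_simp
    rw [this]
    ring
  have hZle : Real.negMulLog (2 / d) + Real.negMulLog (B / d) + Real.negMulLog (1 / d) ≤
      3 / B + ((3 * (j : ℝ) + 1) * Real.log 2) / d := by
    rw [hZ]
    have h1 : Real.log d - Real.log B ≤ 3 / B := by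
      rw [← Real.log_div hdpos.ne' hBpos.ne']
      have := Real.log_le_sub_one_of_pos (show 0 < d / B by positivity)
      have e : d / B - 1 = 3 / B := by rw [hddef]; field_simp; ring
      linarith
    linarith
  -- (Y) the three terms
  have hY0 : Real.negMulLog (α / d) = α / d * (Real.log d - Real.log α) := by
    simp only [Real.negMulLog, Real.log_div hαpos.ne' hdpos.ne']; ring
  have hY2 : Real.negMulLog (γ / d) = γ / d * (Real.log d - Real.log γ) := by
    simp only [Real.negMulLog, Real.log_div hγpos.ne' hdpos.ne']; ring
  have hY1 : τ / d - (τ / d) ^ 2 ≤ Real.negMulLog (1 - τ / d) := by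
    have h1p : 0 < 1 - τ / d := by linarith
    have hlog : Real.log (1 - τ / d) ≤ -(τ / d) := by
      have := Real.log_le_sub_one_of_pos h1p; linarith
    simp only [Real.negMulLog]
    linear_combination mul_le_mul_of_nonneg_left hlog h1p.le
  -- logarithm bounds: `log d ≥ (j+1) log 2`, `log α ≤ log (5/2) + (37/50) ε`, `log γ ≤ −log 2 − 2ε`
  have hlogd : ((j : ℝ) + 1) * Real.log 2 ≤ Real.log d := by
    have : Real.log B ≤ Real.log d := Real.log_le_log hBpos hBd
    rw [hBdef, Real.log_pow] at this; push_cast at this; linarith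
  have hlogα : Real.log α ≤ Real.log (5 / 2) + 37 / 50 * ε := by
    have h := Real.log_le_sub_one_of_pos (show 0 < α / (5 / 2) by positivity)
    rw [Real.log_div hαpos.ne' (by norm_num)] at h
    rw [hαdef] at h ⊢; linarith
  have hlogγ : Real.log γ ≤ -Real.log 2 - 2 * ε := by
    have h := Real.log_le_sub_one_of_pos (show 0 < γ / (1 / 2) by positivity)
    rw [Real.log_div hγpos.ne' (by norm_num), Real.log_div one_ne_zero two_ne_zero,
      Real.log_one] at h
    rw [hγdef] at h ⊢; linarith
  have hl2 := Real.log_two_gt_d9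
  have hl2' := Real.log_two_lt_d9
  have hP := log_five_halves_le
  have hP0 : 0 ≤ Real.log (5 / 2) := Real.log_nonneg (by norm_num)
  -- the key scaled inequality
  have key : 3 / B + ((3 * (j : ℝ) + 1) * Real.log 2) / d ≤
      α / d * (Real.log d - Real.log α) + (τ / d - (τ / d) ^ 2) +
        γ / d * (Real.log d - Real.log γ) := by
    have hA : α * (((j : ℝ) + 1) * Real.log 2 - Real.log (5 / 2) - 37 / 50 * ε) ≤
        α * (Real.log d - Real.log α) := mul_le_mul_of_nonneg_left (by linarith) hαpos.le
    have hG : γ * (((j : ℝ) + 1) * Real.log 2 + Real.log 2 + 2 * ε) ≤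
        γ * (Real.log d - Real.log γ) := mul_le_mul_of_nonneg_left (by linarith) hγpos.le
    -- expand, using `ε j = 1`
    have hexp : α * (((j : ℝ) + 1) * Real.log 2 - Real.log (5 / 2) - 37 / 50 * ε) +
        γ * (((j : ℝ) + 1) * Real.log 2 + Real.log 2 + 2 * ε) =
        3 * ((j : ℝ) + 1) * Real.log 2 + 27 / 20 * Real.log 2 - 5 / 2 * Real.log (5 / 2) -
          17 / 20 * ε - 3 / 20 * (ε * Real.log 2) - 37 / 20 * (ε * Real.log (5 / 2)) -
          3369 / 1000 * ε ^ 2 := by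
      rw [hαdef, hγdef]
      linear_combination (37 / 20 * Real.log 2 - Real.log 2) * hεJ
    -- numeric bounds on the small products
    have hεL : ε * Real.log 2 ≤ 0.0006932 := by
      have := mul_le_mul hεle hl2'.le hlog2.le (by norm_num); linarith
    have hεP : ε * Real.log (5 / 2) ≤ 0.00091662 := by
      have := mul_le_mul hεle hP hP0 (by norm_num); linarith
    have hε2 : ε ^ 2 ≤ 0.000001 := by
      have := pow_le_pow_left₀ hε0 hεle 2; norm_num at this; linarith
    have hB19 : 19 / B ≤ 0.000001 := by
      rw [div_le_iff₀ hBpos]; norm_num at hB1 ⊢; linarith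
    have h19 : 9 / B + 10 / B = 19 / B := by ring
    have hτ2 : τ ^ 2 ≤ 10 := by rw [hτdef]; nlinarith [hεle, hε0]
    have h3dB : 3 * d / B = 3 + 9 / B := by
      rw [hddef]; field_simp; ring
    have hτdB : τ ^ 2 / d ≤ 10 / B := by
      calc τ ^ 2 / d ≤ 10 / d := div_le_div_of_nonneg_right hτ2 hdpos.le
        _ ≤ 10 / B := div_le_div_of_nonneg_left (by norm_num) hBpos hBd
    have hτε : τ = 3 + 17 / 20 * ε := hτdef
    -- the goal multiplied by `d`
    have hscaled : 3 * d / B + (3 * (j : ℝ) + 1) * Real.log 2 ≤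
        α * (Real.log d - Real.log α) + τ - τ ^ 2 / d + γ * (Real.log d - Real.log γ) := by
      rw [h3dB]
      linarith [hA, hG, hexp, hεL, hεP, hε2, hB19, h19, hτdB, hl2, hP, hτε]
    have hdiv := div_le_div_of_nonneg_right hscaled hdpos.le
    have e1 : 3 / B + ((3 * (j : ℝ) + 1) * Real.log 2) / d =
        (3 * d / B + (3 * (j : ℝ) + 1) * Real.log 2) / d := by
      field_simp
    have e2 : α / d * (Real.log d - Real.log α) + (τ / d - (τ / d) ^ 2) +
        γ / d * (Real.log d - Real.log γ) =
        (α * (Real.log d - Real.log α) + τ - τ ^ 2 / d + γ * (Real.log d - Real.log γ)) / d := by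
      field_simp; ring
    rw [e1, e2]; exact hdiv
  linarith [hZle, hY0, hY1, hY2, key]

/-! ## The rung -/

/-- **`TwinSaturation`** (route `SaturationLadder`, aside stmt-MatrixMultiplication-30539): there is
`C` such that for every `t ∈ [0, 1)` some `r ∈ [1, C · 3^{1/(1−t)}]` has `ω(1, t, r) ≤ 1 + r`.
[cite: CoppersmithWinograd1990, §8] [cite: AlmanDuanVassilevskaWilliamsXuXuZhou2025, Thm. 3.2, §3.4] -/
theorem twinSaturation : TwinSaturation :=
  twinSaturation_of_familyY 1000 (by norm_num) fun j hj => familyY j hj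

end Summit.MatrixMultiplication.MatrixMultiplication.Theorems.SaturationLadderTwinSaturation

end
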